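import Summits.ResolutionOfSingularities.ResolutionOfSingularities.Theorems.PurelyInseparableDim4PhiLineLinearFrame
import Summits.ResolutionOfSingularities.ResolutionOfSingularities.Theorems.PurelyInseparableDim4PhiLineCleaningBlind
import Literature.AlgebraicGeometry.Resolution.PointBlowupPolygonLawsU2Indexed
import Literature.AlgebraicGeometry.Resolution.PointBlowupPolygonLawsIndexed
import HarnessLib

/-!
# (K-Φ2) chain dictionary IV: the ONE-STEP LAWS of the β_h line for the TREE's states in carried linear frames

Cell `res-dim4-pi` (D-0157 DOOR 2), Φ = β_h line of res-dim4-idea-1 (CARD I-1-8 claims (C1 LAW)/(C4 MONO): «KEEP-h: β′ ≤ β − (1 − α) < β;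
LOSE-h (after the twist ũ₂ = u₂ − λu₁): β′ = γ̃⁻ ≤ β»). The tree's ABSTRACT laws (`WeightedOrder.betaS_colon_u2_lt`, CJS Lemma 12.2 (5) /
13.4 (3); `WeightedOrder.betaS_colon_le`, Lemma 12.1 (3)) speak about a ring map `φ`, frames `c, c′` with pivot relations, and the weak
transform `(J R′ : φ(pivot)^μ)`. (K-Φ2) I–III and (K-Φ3) V make them statements about the TREE STEP `CentreBlowup.step p univ j b s` of a
presented state `s.F = x^r · G` read in a carried LINEAR frame of `𝒪 = OriginLocalization K 4`:

* **`betaS_step_lt_of_keep`** — KEEP-h step (chart `m = u₂`-letter, `b_m = b_h = 0`, critical letter `h = u₁` with `r_h + d = p`, frame rows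
  through the new point, `α < 1`, `δ > 1`): the next residual `G′` (`(step …).F = x^{r′} G′`, shade still `≥ d`) has, in the ARRIVAL frame
  (rows with the `m`-th coefficient dropped; `u₁ = x_h`, `u₂ = x_m`), a NON-EMPTY polygon with the SAME `αs` and `βs′ < βs`;
* **`betaS_step_le_of_lose`** — LOSE-h step (chart `h = u₁`-letter, twisted step frame `ũ₂ = x_m − b_m x_h`, new critical letter `x_h` with
  `r′_h + d ≤ p`, `p ∤ r′_h`, `δ < 2` so that `α′ < 1`): non-empty polygon, `αs′ + d! = δs`, `βs′ ≤ βs`.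

Assembly: `Localization.localRingHom` of the chart substitution (`localRingHom_chart_*`, (K-Φ2) I), linear frames generate `𝔪`
(`span_range_linearFrame_eq_maximalIdeal`, III), weak transform `= (H₀)` (`colon_map_span_singleton_chart`, I), next residual
`G′ = ε H₀ + R̃` (`step_F_eq_monomial_mul_residual`, II), `β((G′)) = β((H₀))` (`pts_nonempty_and_alphaS_betaS_eq_of_cleaning`, (K-Φ3) V).
[OURS · counted 0 · AI work weaker than expert review.] Nothing here proves K2(p), the β_h line, or resolution of singularities in dimension ≥ 4 /
characteristic p.

Sources: V. Cossart, U. Jannsen, S. Saito, LNM **2270** (2020), Lemma 12.1 (3), Lemma 12.2 (3)/(5), Lemma 13.4 (3), Lemma 13.6 [`CossartJannsenSaito2020`];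
V. Cossart, O. Piltant, J. Algebra 320 (2008), (16), Lemma 4.5 [`CossartPiltant2008`]; H. Hauser, BAMS 47 (2010) §§F–G [`Hauser2010`].
-/

set_option linter.dupNamespace false

noncomputable section

namespace Summit.ResolutionOfSingularities.ResolutionOfSingularities.Theorems.PIDim4

namespace PhiLine

open MvPolynomial Finset IsLocalRing
open Literature.AlgebraicGeometry.Resolution
open Literature.AlgebraicGeometry.Resolution.Hauser2010
open Literature.AlgebraicGeometry.Resolution.WeightedOrder

variable {K : Type} [Field K]

/-! ## Bookkeeping on rows of a linear frame -/

/-- The row `e_k` reads the variable `x_k`: `Σ_s C (e_k s) x_s = x_k`. [folklore] -/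
theorem sum_C_single_mul_X (k : Fin 4) : (∑ s, C ((Pi.single k 1 : Fin 4 → K) s) * X s : MvPolynomial (Fin 4) K) = X k := by
  rw [Finset.sum_eq_single k (fun s _ hs => by rw [Pi.single_eq_of_ne hs, C_0, zero_mul]) (fun h => absurd (Finset.mem_univ k) h),
    Pi.single_eq_same, C_1, one_mul]

/-- Dropping the `m`-th coefficient of `e_k` (`k ≠ m`) changes nothing. [folklore] -/
theorem update_single_of_ne {k m : Fin 4} (hkm : k ≠ m) : Function.update (Pi.single k 1 : Fin 4 → K) m 0 = Pi.single k 1 := by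
  funext s
  by_cases hs : s = m
  · subst hs; rw [Function.update_self, Pi.single_eq_of_ne' hkm]
  · rw [Function.update_of_ne hs]

/-- `ringKrullDim 𝒪 = 2 + 2`. [folklore] -/
theorem ringKrullDim_originLocalization_two_add_two : ringKrullDim (OriginLocalization K 4) = (2 : ℕ) + 2 := by
  rw [ringKrullDim_originLocalization]; norm_num

/-- `ord₀ H₀ ≥ d` when `G′ = ε H₀ + R` has `ord₀ G′ ≥ d`, `R ∈ (x_h^d)` and `ε(0) ≠ 0`. [cite: Hauser2010, §F] -/
theorem le_ordZero_of_eq_unit_mul_add {d : ℕ} {G' ε H₀ R : MvPolynomial (Fin 4) K} (hG' : G' = ε * H₀ + R) (hd : (d : ℕ∞) ≤ ordZero G')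
    (hε : constantCoeff ε ≠ 0) {h : Fin 4} (hR : R ∈ Ideal.span {(X h : MvPolynomial (Fin 4) K) ^ d}) : (d : ℕ∞) ≤ ordZero H₀ := by
  have hR' : (d : ℕ∞) ≤ ordZero R := by
    obtain ⟨q, rfl⟩ := Ideal.mem_span_singleton'.mp hR
    rw [ordZero_mul, ordZero_X_pow]
    exact le_add_self
  have hεH : (d : ℕ∞) ≤ ordZero (ε * H₀) := by
    have : ε * H₀ = G' - R := by rw [hG']; ring
    rw [this]
    exact le_ordZero_sub hd hR'
  rwa [ordZero_mul, (ordZero_eq_zero_iff ε).mpr hε, zero_add] at hεH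

/-! ## The KEEP-h step -/

/-- **KEEP-h ONE-STEP LAW for the tree's states (CJS Lemma 12.2 (5) / 13.4 (3); Cossart–Piltant (16)).** Let `s.F = x^r · G` with
`ord₀ G = d`, `1 ≤ d < p`, `p ≤ |r| + d`, critical letter `h` (`r_h + d = p`), chart letter `m ≠ h`, new point `b` with `b_m = b_h = 0`
(the point stays on `E_h`). Let `L` be a linear STEP frame with rows `u₁ = e_h`, `u₂ = e_m`, left-invertible (`M`), whose non-pivot rows pass
through the new point (`Σ_t L_{i t} (b + e_m)_t = 0`), in which `(G)` has a non-empty polygon, `δ > 1` and `α < 1`; let `L′` be the ARRIVAL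
frame (`m`-th coefficients dropped, `u₂ = e_m`), left-invertible (`M′`). If the next state `(step p univ m b s).F = x^{r′} · G′` still has
`ord₀ G′ ≥ d`, then in the arrival frame `(G′)` has a non-empty polygon, the same `αs`, and **`βs′ < βs`**.
[cite: CossartJannsenSaito2020, Lemma 13.4 (3)] [cite: CossartPiltant2008, (16)] -/
theorem betaS_step_lt_of_keep {p d : ℕ} [DecidableEq K] {s : State K} {r : Fin 4 →₀ ℕ} {G : MvPolynomial (Fin 4) K}
    (hF : s.F = monomial r 1 * G) (hd : ordZero G = d) (hd1 : 1 ≤ d) (hdp : d < p) (hp : p ≤ r.degree + d)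
    {h m : Fin 4} (hhm : h ≠ m) (hcrit : r h + d = p) {b : Fin 4 → K} (hbm : b m = 0) (hbh : b h = 0)
    (L L' : Fin (2 + 2) → Fin 4 → K) (M M' : Fin 4 → Fin (2 + 2) → K)
    (hM : ∀ t u, ∑ i, M t i * L i u = if t = u then 1 else 0) (hM' : ∀ t u, ∑ i, M' t i * L' i u = if t = u then 1 else 0)
    (hLu1 : L (u1 2) = Pi.single h 1) (hLu2 : L (u2 2) = Pi.single m 1)
    (hnear : ∀ i, i ≠ u2 2 → ∑ t, L i t * Function.update b m 1 t = 0)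
    (hL'u2 : L' (u2 2) = Pi.single m 1) (hL' : ∀ i, i ≠ u2 2 → L' i = Function.update (L i) m 0)
    (hne : (pts (fun i => algebraMap (MvPolynomial (Fin 4) K) (OriginLocalization K 4) (∑ t, C (L i t) * X t))
      (Ideal.span {algebraMap (MvPolynomial (Fin 4) K) (OriginLocalization K 4) G}) d).Nonempty)
    (hδ : d.factorial < deltaS (fun i => algebraMap (MvPolynomial (Fin 4) K) (OriginLocalization K 4) (∑ t, C (L i t) * X t))
      (Ideal.span {algebraMap (MvPolynomial (Fin 4) K) (OriginLocalization K 4) G}) d)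
    (hα : alphaS (fun i => algebraMap (MvPolynomial (Fin 4) K) (OriginLocalization K 4) (∑ t, C (L i t) * X t))
      (Ideal.span {algebraMap (MvPolynomial (Fin 4) K) (OriginLocalization K 4) G}) d < d.factorial)
    {G' : MvPolynomial (Fin 4) K}
    (hF' : (CentreBlowup.step p Finset.univ m b s).F = monomial ((r.filter fun i => b i = 0).update m (r.degree + d - p)) 1 * G')
    (hd' : (d : ℕ∞) ≤ ordZero G') :
    (pts (fun i => algebraMap (MvPolynomial (Fin 4) K) (OriginLocalization K 4) (∑ t, C (L' i t) * X t))
        (Ideal.span {algebraMap (MvPolynomial (Fin 4) K) (OriginLocalization K 4) G'}) d).Nonempty ∧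
      alphaS (fun i => algebraMap (MvPolynomial (Fin 4) K) (OriginLocalization K 4) (∑ t, C (L' i t) * X t))
          (Ideal.span {algebraMap (MvPolynomial (Fin 4) K) (OriginLocalization K 4) G'}) d =
        alphaS (fun i => algebraMap (MvPolynomial (Fin 4) K) (OriginLocalization K 4) (∑ t, C (L i t) * X t))
          (Ideal.span {algebraMap (MvPolynomial (Fin 4) K) (OriginLocalization K 4) G}) d ∧
      betaS (fun i => algebraMap (MvPolynomial (Fin 4) K) (OriginLocalization K 4) (∑ t, C (L' i t) * X t))
          (Ideal.span {algebraMap (MvPolynomial (Fin 4) K) (OriginLocalization K 4) G'}) d <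
        betaS (fun i => algebraMap (MvPolynomial (Fin 4) K) (OriginLocalization K 4) (∑ t, C (L i t) * X t))
          (Ideal.span {algebraMap (MvPolynomial (Fin 4) K) (OriginLocalization K 4) G}) d := by
  -- abbreviations
  set alg := algebraMap (MvPolynomial (Fin 4) K) (OriginLocalization K 4) with halg
  set c : Fin (2 + 2) → OriginLocalization K 4 := fun i => alg (∑ t, C (L i t) * X t) with hc
  set c' : Fin (2 + 2) → OriginLocalization K 4 := fun i => alg (∑ t, C (L' i t) * X t) with hc'
  set J : Ideal (OriginLocalization K 4) := Ideal.span {alg G} with hJ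
  set φ := Localization.localRingHom (Literature.AlgebraicGeometry.Resolution.originIdeal K 4)
      (Literature.AlgebraicGeometry.Resolution.originIdeal K 4)
      (((aeval fun i => (X i + C (b i) : MvPolynomial (Fin 4) K)).comp
        (coordBlowupSubst K (↑(Finset.univ : Finset (Fin 4))) m)).toRingHom)
      (comap_translate_coordBlowupSubst_originIdeal hbm) with hφ
  have hdG : (d : ℕ∞) ≤ ordZero G := hd.symm.le
  -- the frames
  have hcu2 : c (u2 2) = alg (X m) := by simp only [hc, hLu2, sum_C_single_mul_X]
  have hc'u2 : c' (u2 2) = alg (X m) := by simp only [hc', hL'u2, sum_C_single_mul_X]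
  have hc'u1 : c' (u1 2) = alg (X h) := by
    simp only [hc', hL' (u1 2) u1_ne_u2, hLu1, update_single_of_ne hhm, sum_C_single_mul_X]
  have hpiv : c' (u2 2) = φ (c (u2 2)) := by rw [hc'u2, hcu2, hφ, localRingHom_chart_X_self hbm]
  have hoth : ∀ i, i ≠ u2 2 → φ (c i) = φ (c (u2 2)) * c' i := by
    intro i hi
    rw [hcu2, hφ, localRingHom_chart_X_self hbm]
    change Localization.localRingHom _ _ _ _ (alg (∑ t, C (L i t) * X t)) = alg (X m) * alg (∑ t, C (L' i t) * X t)
    rw [hL' i hi, halg, localRingHom_chart_linearForm hbm (L i) (hnear i hi)]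
  have hgen : Ideal.span (Set.range c) = maximalIdeal _ := span_range_linearFrame_eq_maximalIdeal L M hM
  have hgen' : Ideal.span (Set.range c') = maximalIdeal _ := span_range_linearFrame_eq_maximalIdeal L' M' hM'
  have hdim := ringKrullDim_originLocalization_two_add_two (K := K)
  have hJμ : J ≤ maximalIdeal _ ^ d := span_singleton_algebraMap_le_maximalIdeal_pow hdG
  -- the abstract KEEP law
  have hlaw := betaS_colon_u2_lt φ hpiv hoth hgen hdim hgen' hdim hJμ hne hδ hα
  have hαlaw := alphaS_colon_u2_eq φ hpiv hoth hgen hdim hgen' hdim hJμ hne hδ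
  obtain ⟨e₀, he₀, -⟩ := exists_pts_colon_u2_v φ hpiv hoth hgen hdim hgen' hdim hJμ hne hδ
  -- the weak transform is `(H₀)`
  have hcolon : (J.map φ).colon {φ (c (u2 2)) ^ d} =
      Ideal.span {alg (PointBlowup.translate b (CentreBlowup.chartTransform d Finset.univ m G))} := by
    rw [hcu2, hφ, localRingHom_chart_X_self hbm, hJ, halg]
    exact colon_map_span_singleton_chart hbm G hdG
  rw [hcolon] at hlaw hαlaw he₀
  -- the next residual `G′ = ε H₀ + R`
  obtain ⟨R, hstep, hRmem⟩ := step_F_eq_monomial_mul_residual (p := p) hF hdG hp m hbm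
  rw [hF', monomial_one_mul_cancel_left_iff] at hstep
  -- exponent of the critical letter after the step: `r′_h = r_h = p − d`
  have hr'h : ((r.filter fun i => b i = 0).update m (r.degree + d - p)) h = p - d := by
    rw [Finsupp.coe_update, Function.update_of_ne hhm, Finsupp.filter_apply_pos (fun i => b i = 0) r hbh]; omega
  have hndvd : ¬ p ∣ ((r.filter fun i => b i = 0).update m (r.degree + d - p)) h := by
    rw [hr'h]
    intro hdvd
    exact absurd (Nat.le_of_dvd (by omega) hdvd) (by omega)
  have hR : R ∈ Ideal.span {(X h : MvPolynomial (Fin 4) K) ^ d} := by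
    have := hRmem h hndvd
    rwa [hr'h, show p - (p - d) = d by omega] at this
  -- (K-Φ3) V: cleaning and the unit do not move `v`
  have hε := constantCoeff_prod_ne_zero b (fun i => r i)
  have hH₀ : (d : ℕ∞) ≤ ordZero (PointBlowup.translate b (CentreBlowup.chartTransform d Finset.univ m G)) :=
    le_ordZero_of_eq_unit_mul_add hstep hd' hε hR
  have hclean := pts_nonempty_and_alphaS_betaS_eq_of_cleaning c' hgen' hdim (isUnit_algebraMap_of_constantCoeff_ne_zero hε)
    (span_singleton_algebraMap_le_maximalIdeal_pow hH₀) ⟨e₀, he₀⟩ (by rw [hαlaw]; exact hα)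
    (ρ := alg R) (by rw [hc'u1]; exact algebraMap_mem_span_pow_of_mem_span_pow le_rfl hR)
  have hG' : Ideal.span {alg G'} = Ideal.span {alg (∏ i ∈ Finset.univ.filter (fun i => b i ≠ 0), (X i + C (b i)) ^ r i) *
      alg (PointBlowup.translate b (CentreBlowup.chartTransform d Finset.univ m G)) + alg R} := by
    rw [hstep, map_add, map_mul]
  rw [hG']
  exact ⟨hclean.1, hclean.2.1.trans hαlaw, hclean.2.2.trans_lt hlaw⟩

/-! ## The LOSE-h step (chart = the critical letter, twisted step frame) -/

/-- **LOSE-h ONE-STEP LAW for the tree's states (CJS Lemma 12.1 (3) after the twist of Lemma 13.6; Cossart–Piltant Lemma 4.5 (2)).** Let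
`s.F = x^r · G` with `ord₀ G = d`, `p ≤ |r| + d`, chart letter `h` (the critical letter), new point `b` with `b_h = 0`. Let `L` be a linear
STEP frame with row `u₁ = e_h` (the TWISTED `u₂`, e.g. `e_m − b_m e_h`, and the `y`-rows all pass through the new point:
`Σ_t L_{i t} (b + e_h)_t = 0` for `i ≠ u₁`), left-invertible, with non-empty polygon and `1 < δ < 2` for `(G)`; let `L′` be the ARRIVAL frame
(`h`-th coefficients dropped off the pivot row, `u₁ = e_h` = the NEWBORN critical letter), left-invertible. If the new exponent
`r′_h = |r| + d − p` satisfies `p ∤ r′_h`, `r′_h + d ≤ p`, and the next state `(step p univ h b s).F = x^{r′} · G′` has `ord₀ G′ ≥ d`, then in the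
arrival frame `(G′)` has a non-empty polygon, **`αs′ + d! = δs`** (so `α′ < 1`) and **`βs′ ≤ βs`**.
[cite: CossartJannsenSaito2020, Lemma 12.1 (3)] [cite: CossartPiltant2008, Lemma 4.5 (2)] -/
theorem betaS_step_le_of_lose {p d : ℕ} [DecidableEq K] {s : State K} {r : Fin 4 →₀ ℕ} {G : MvPolynomial (Fin 4) K}
    (hF : s.F = monomial r 1 * G) (hd : ordZero G = d) (hp : p ≤ r.degree + d)
    {h : Fin 4} {b : Fin 4 → K} (hbh : b h = 0)
    (hndvd : ¬ p ∣ (r.degree + d - p)) (hcrit' : r.degree + d - p + d ≤ p)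
    (L L' : Fin (2 + 2) → Fin 4 → K) (M M' : Fin 4 → Fin (2 + 2) → K)
    (hM : ∀ t u, ∑ i, M t i * L i u = if t = u then 1 else 0) (hM' : ∀ t u, ∑ i, M' t i * L' i u = if t = u then 1 else 0)
    (hLu1 : L (u1 2) = Pi.single h 1)
    (hnear : ∀ i, i ≠ u1 2 → ∑ t, L i t * Function.update b h 1 t = 0)
    (hL'u1 : L' (u1 2) = Pi.single h 1) (hL' : ∀ i, i ≠ u1 2 → L' i = Function.update (L i) h 0)
    (hne : (pts (fun i => algebraMap (MvPolynomial (Fin 4) K) (OriginLocalization K 4) (∑ t, C (L i t) * X t))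
      (Ideal.span {algebraMap (MvPolynomial (Fin 4) K) (OriginLocalization K 4) G}) d).Nonempty)
    (hδ : d.factorial < deltaS (fun i => algebraMap (MvPolynomial (Fin 4) K) (OriginLocalization K 4) (∑ t, C (L i t) * X t))
      (Ideal.span {algebraMap (MvPolynomial (Fin 4) K) (OriginLocalization K 4) G}) d)
    (hδ2 : deltaS (fun i => algebraMap (MvPolynomial (Fin 4) K) (OriginLocalization K 4) (∑ t, C (L i t) * X t))
      (Ideal.span {algebraMap (MvPolynomial (Fin 4) K) (OriginLocalization K 4) G}) d < 2 * d.factorial)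
    {G' : MvPolynomial (Fin 4) K}
    (hF' : (CentreBlowup.step p Finset.univ h b s).F = monomial ((r.filter fun i => b i = 0).update h (r.degree + d - p)) 1 * G')
    (hd' : (d : ℕ∞) ≤ ordZero G') :
    (pts (fun i => algebraMap (MvPolynomial (Fin 4) K) (OriginLocalization K 4) (∑ t, C (L' i t) * X t))
        (Ideal.span {algebraMap (MvPolynomial (Fin 4) K) (OriginLocalization K 4) G'}) d).Nonempty ∧
      alphaS (fun i => algebraMap (MvPolynomial (Fin 4) K) (OriginLocalization K 4) (∑ t, C (L' i t) * X t))
          (Ideal.span {algebraMap (MvPolynomial (Fin 4) K) (OriginLocalization K 4) G'}) d + d.factorial =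
        deltaS (fun i => algebraMap (MvPolynomial (Fin 4) K) (OriginLocalization K 4) (∑ t, C (L i t) * X t))
          (Ideal.span {algebraMap (MvPolynomial (Fin 4) K) (OriginLocalization K 4) G}) d ∧
      betaS (fun i => algebraMap (MvPolynomial (Fin 4) K) (OriginLocalization K 4) (∑ t, C (L' i t) * X t))
          (Ideal.span {algebraMap (MvPolynomial (Fin 4) K) (OriginLocalization K 4) G'}) d ≤
        betaS (fun i => algebraMap (MvPolynomial (Fin 4) K) (OriginLocalization K 4) (∑ t, C (L i t) * X t))
          (Ideal.span {algebraMap (MvPolynomial (Fin 4) K) (OriginLocalization K 4) G}) d := by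
  set alg := algebraMap (MvPolynomial (Fin 4) K) (OriginLocalization K 4) with halg
  set c : Fin (2 + 2) → OriginLocalization K 4 := fun i => alg (∑ t, C (L i t) * X t) with hc
  set c' : Fin (2 + 2) → OriginLocalization K 4 := fun i => alg (∑ t, C (L' i t) * X t) with hc'
  set J : Ideal (OriginLocalization K 4) := Ideal.span {alg G} with hJ
  set φ := Localization.localRingHom (Literature.AlgebraicGeometry.Resolution.originIdeal K 4)
      (Literature.AlgebraicGeometry.Resolution.originIdeal K 4)
      (((aeval fun i => (X i + C (b i) : MvPolynomial (Fin 4) K)).comp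
        (coordBlowupSubst K (↑(Finset.univ : Finset (Fin 4))) h)).toRingHom)
      (comap_translate_coordBlowupSubst_originIdeal hbh) with hφ
  have hdG : (d : ℕ∞) ≤ ordZero G := hd.symm.le
  have hcu1 : c (u1 2) = alg (X h) := by simp only [hc, hLu1, sum_C_single_mul_X]
  have hc'u1 : c' (u1 2) = alg (X h) := by simp only [hc', hL'u1, sum_C_single_mul_X]
  have hpiv : c' (u1 2) = φ (c (u1 2)) := by rw [hc'u1, hcu1, hφ, localRingHom_chart_X_self hbh]
  have hoth : ∀ i, i ≠ u1 2 → φ (c i) = φ (c (u1 2)) * c' i := by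
    intro i hi
    rw [hcu1, hφ, localRingHom_chart_X_self hbh]
    change Localization.localRingHom _ _ _ _ (alg (∑ t, C (L i t) * X t)) = alg (X h) * alg (∑ t, C (L' i t) * X t)
    rw [hL' i hi, halg, localRingHom_chart_linearForm hbh (L i) (hnear i hi)]
  have hgen : Ideal.span (Set.range c) = maximalIdeal _ := span_range_linearFrame_eq_maximalIdeal L M hM
  have hgen' : Ideal.span (Set.range c') = maximalIdeal _ := span_range_linearFrame_eq_maximalIdeal L' M' hM'
  have hdim := ringKrullDim_originLocalization_two_add_two (K := K)
  have hJμ : J ≤ maximalIdeal _ ^ d := span_singleton_algebraMap_le_maximalIdeal_pow hdG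
  -- the abstract LOSE law (`u₁`-chart)
  have hne' := pts_colon_nonempty φ hpiv hoth hgen hdim hgen' hdim hJμ hne hδ
  have hαlaw := alphaS_colon_add φ hpiv hoth hgen hdim hgen' hdim hJμ hne hδ
  have hβlaw := betaS_colon_le φ hpiv hoth hgen hdim hgen' hdim hJμ hne hδ
  have hcolon : (J.map φ).colon {φ (c (u1 2)) ^ d} =
      Ideal.span {alg (PointBlowup.translate b (CentreBlowup.chartTransform d Finset.univ h G))} := by
    rw [hcu1, hφ, localRingHom_chart_X_self hbh, hJ, halg]
    exact colon_map_span_singleton_chart hbh G hdG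
  rw [hcolon] at hne' hαlaw hβlaw
  -- the next residual
  obtain ⟨R, hstep, hRmem⟩ := step_F_eq_monomial_mul_residual (p := p) hF hdG hp h hbh
  rw [hF', monomial_one_mul_cancel_left_iff] at hstep
  have hr'h : ((r.filter fun i => b i = 0).update h (r.degree + d - p)) h = r.degree + d - p := by
    rw [Finsupp.coe_update, Function.update_self]
  have hR : R ∈ Ideal.span {(X h : MvPolynomial (Fin 4) K) ^ (p - (r.degree + d - p))} := by
    have := hRmem h (by rw [hr'h]; exact hndvd)
    rwa [hr'h] at this
  have hRd : R ∈ Ideal.span {(X h : MvPolynomial (Fin 4) K) ^ d} := by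
    obtain ⟨q, rfl⟩ := Ideal.mem_span_singleton'.mp hR
    obtain ⟨k, hk⟩ := Nat.exists_eq_add_of_le (show d ≤ p - (r.degree + d - p) by omega)
    rw [hk, Ideal.mem_span_singleton]
    exact Dvd.dvd.mul_left (pow_dvd_pow (X h) (Nat.le_add_right d k)) _
  have hε := constantCoeff_prod_ne_zero b (fun i => r i)
  have hH₀ : (d : ℕ∞) ≤ ordZero (PointBlowup.translate b (CentreBlowup.chartTransform d Finset.univ h G)) :=
    le_ordZero_of_eq_unit_mul_add hstep hd' hε hRd
  have hα' : alphaS c' (Ideal.span {alg (PointBlowup.translate b (CentreBlowup.chartTransform d Finset.univ h G))}) d < d.factorial := by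
    omega
  have hclean := pts_nonempty_and_alphaS_betaS_eq_of_cleaning c' hgen' hdim (isUnit_algebraMap_of_constantCoeff_ne_zero hε)
    (span_singleton_algebraMap_le_maximalIdeal_pow hH₀) hne' hα'
    (ρ := alg R) (by rw [hc'u1]; exact algebraMap_mem_span_pow_of_mem_span_pow le_rfl hRd)
  have hG' : Ideal.span {alg G'} = Ideal.span {alg (∏ i ∈ Finset.univ.filter (fun i => b i ≠ 0), (X i + C (b i)) ^ r i) *
      alg (PointBlowup.translate b (CentreBlowup.chartTransform d Finset.univ h G)) + alg R} := by
    rw [hstep, map_add, map_mul]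
  rw [hG']
  refine ⟨hclean.1, ?_, hclean.2.2.trans_le hβlaw⟩
  rw [hclean.2.1]; exact hαlaw

end PhiLine

end Summit.ResolutionOfSingularities.ResolutionOfSingularities.Theorems.PIDim4

end
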